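import Mathlib
import Summits.NavierStokesRegularity.NavierStokesRegularity.Theorems.WakeRatchetTailRatchetDyadicScalarFrames
import Summits.NavierStokesRegularity.NavierStokesRegularity.Theorems.WakeRatchetTailRatchetStallLimit
import HarnessLib

/-!
# `WakeRatchet.TailRatchet` (stmt-NavierStokesRegularity-21808), door D4′ — the scalar extraction, part 2:
# the admissible eternal LIMIT of bounded frames as a standalone object, and firing in WINDOWS

Def-free sequel to `WakeRatchetTailRatchetDyadicScalarFrames`.  MODEL lattice ODEs only (the scalar dyadic
member of Tao 2016 §1.2 / §4 in the renormalised variables of §6.4); nothing in this file is a statement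
about the Navier–Stokes equations; stmt-21808 is neither proved nor refuted here and no stub is closed.

* `scalarEternal_of_frameLimit` — a continuous limit `W` of bounded scalar frames of the renormalised dyadic
  lattice (half-lines `σ > A_j`, `A_j → −∞`) with a uniform window-mass bound and per-shell forward energy
  bounds IS a scalar admissible eternal solution: lattice law everywhere, `Integrable |W n|` with
  `∫|W n| ≤ M`, forward energy bound, `|W| ≤ B`, every shell continuous — the hypotheses of
  `WakeRatchetDyadicScalarEternal.isEternal_dyadic_of_scalar` / `tailRatchet_false_of_scalarPersistentFiring`.
* `tendsto_subseq_of_cc` — continuous convergence passes to subsequences (scalar form of the tree's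
  `WakeRatchetStallLimit.tendsto_subseq_of_seqConverge`).
* `persistentFiring_of_windows` — if, for every `k`, eventually in `j` the forward shell `n₀ + k` of frame `j`
  reaches level `c` SOMEWHERE in the window `[σ₀, σ₀ + g_k]`, the continuous limit reaches level `c` in
  the same window (Bolzano–Weierstrass on the window + continuous convergence along the subsequence).
* `tailRatchet_false_of_scalarFramesWindow` — THE KILL CRITERION OF RECORD FOR DOOR D4′: at arbitrarily
  small `ε₀`, bounded scalar frames of the renormalised dyadic lattice on growing half-lines with a
  uniform window-mass bound, per-shell forward energy bounds, and firing of every forward shell `n₀ + k`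
  within a recentred log-time window `[σ₀, σ₀ + g_k]` (eventually in the frame index) refute `TailRatchet`.
  Recentring the frames of `WakeRatchetDyadicCauchy.blowup_frames_bounded` at the firing times of
  consecutive shells makes the firing hypothesis a FIRING-GAP bound `s_{m+k} − s_m ≤ g_k` (tree
  `WakeRatchetFiringClock.firing_gap_le`); what remains is (Q)+(D) ⇒ window mass, forward energy, gaps.

HONEST FRAMING: compactness bookkeeping; (Q), (D) and the gap bounds for the one-shell dyadic blow-up are
NOT addressed; rung 0.
-/

noncomputable section

set_option linter.dupNamespace false

namespace Summit.NavierStokesRegularity.NavierStokesRegularity.Theorems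

namespace WakeRatchetDyadicScalarEternal

open Set Filter Topology MeasureTheory intervalIntegral
open Literature.Analysis.FluidPDE Literature.Analysis.FluidPDE.TaoCascade
open Summit.NavierStokesRegularity.NavierStokesRegularity.Theses.WakeRatchet

/-! ## The limit of bounded frames is a scalar admissible eternal solution -/

/-- **THE LIMIT OBJECT.**  Bounded scalar frames of the renormalised dyadic lattice (`Λ > 0`) on half-lines
`σ > A_j`, `A_j → −∞`, with a uniform window-mass bound `∫_a^b |V_j n| ≤ M` and per-shell forward energy
bounds, converging continuously to `W`: then `W` solves the lattice everywhere, every `|W n|` is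
integrable with `∫|W n| ≤ M`, the forward energy bounds and the uniform bound hold for `W`, and every
shell of `W` is continuous.
[cite: Tao2016AveragedNS, §1.2, §4 Lemma 4.1 (4.8), §6.4; elementary] -/
theorem scalarEternal_of_frameLimit {Λ B M : ℝ} (hΛ : 0 < Λ) {V : ℕ → ℤ → ℝ → ℝ} {W : ℤ → ℝ → ℝ}
    {A : ℕ → ℝ} (hA : Tendsto A atTop atBot)
    (hlaw : ∀ (j : ℕ) (n : ℤ) (σ : ℝ), A j < σ → HasDerivAt (V j n)
      (-(V j n σ) + Λ * V j (n - 1) σ ^ 2 - Λ⁻¹ * V j n σ * V j (n + 1) σ) σ)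
    (hB : ∀ (j : ℕ) (n : ℤ) (σ : ℝ), A j < σ → |V j n σ| ≤ B)
    (hmass : ∀ (j : ℕ) (n : ℤ) (a b : ℝ), A j < a → a ≤ b → ∫ u in a..b, |V j n u| ≤ M)
    (hfwd : ∀ n : ℤ, ∃ σ₁ P : ℝ, ∀ (j : ℕ) (σ : ℝ), σ₁ ≤ σ → A j < σ →
      Real.exp (2 * σ) * V j n σ ^ 2 ≤ P)
    (hcc : ∀ (n : ℤ) (u : ℕ → ℝ) (σ : ℝ), Tendsto u atTop (𝓝 σ) →
      Tendsto (fun j => V j n (u j)) atTop (𝓝 (W n σ))) :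
    (∀ (n : ℤ) (σ : ℝ), HasDerivAt (W n)
      (-(W n σ) + Λ * W (n - 1) σ ^ 2 - Λ⁻¹ * W n σ * W (n + 1) σ) σ) ∧
    (∀ n : ℤ, Integrable (fun σ => |W n σ|) ∧ ∫ σ, |W n σ| ≤ M) ∧
    (∀ n : ℤ, ∃ σ₁ P : ℝ, ∀ σ, σ₁ ≤ σ → Real.exp (2 * σ) * W n σ ^ 2 ≤ P) ∧
    (∀ (n : ℤ) (σ : ℝ), |W n σ| ≤ B) ∧
    (∀ n : ℤ, Continuous (W n)) := by
  have hpt : ∀ (n : ℤ) (σ : ℝ), Tendsto (fun j => V j n σ) atTop (𝓝 (W n σ)) :=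
    fun n σ => hcc n _ σ tendsto_const_nhds
  have hev : ∀ a : ℝ, ∀ᶠ j in atTop, A j < a := fun a => hA.eventually (eventually_lt_atBot a)
  obtain ⟨hWcont, hWlaw⟩ := lattice_law_of_cc hΛ hA hlaw hB hcc
  have hVcont : ∀ (j : ℕ) (n : ℤ), ContinuousOn (V j n) (Ioi (A j)) := fun j n u hu =>
    (hlaw j n u hu).continuousAt.continuousWithinAt
  refine ⟨hWlaw, fun n => ?_, fun n => ?_, fun n σ => ?_, hWcont⟩
  · exact integrable_of_windowMass (hWcont n) fun a b hab =>
      windowMass_of_cc hA hVcont hB hmass hpt n hab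
  · obtain ⟨σ₁, P, hP⟩ := hfwd n
    refine ⟨σ₁, P, fun σ hσ => ?_⟩
    have h1 : Tendsto (fun j => Real.exp (2 * σ) * V j n σ ^ 2) atTop
        (𝓝 (Real.exp (2 * σ) * W n σ ^ 2)) := tendsto_const_nhds.mul ((hpt n σ).pow 2)
    refine le_of_tendsto h1 ?_
    filter_upwards [hev σ] with j hj using hP j σ hσ hj
  · refine le_of_tendsto ((continuous_abs.tendsto _).comp (hpt n σ)) ?_
    filter_upwards [hev σ] with j hj using hB j n σ hj

/-! ## Firing in windows passes to the limit -/

/-- Continuous convergence passes to subsequences (scalar form).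
[cite: Tao2016AveragedNS, §4 (statement shape only); elementary] -/
theorem tendsto_subseq_of_cc {V : ℕ → ℤ → ℝ → ℝ} {W : ℤ → ℝ → ℝ}
    (hcc : ∀ (n : ℤ) (u : ℕ → ℝ) (σ : ℝ), Tendsto u atTop (𝓝 σ) →
      Tendsto (fun j => V j n (u j)) atTop (𝓝 (W n σ)))
    (n : ℤ) {φ : ℕ → ℕ} (hφ : StrictMono φ) {u : ℕ → ℝ} {σ : ℝ} (hu : Tendsto u atTop (𝓝 σ)) :
    Tendsto (fun i => V (φ i) n (u i)) atTop (𝓝 (W n σ)) := by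
  have h := (hcc n _ σ (WakeRatchetStallLimit.tendsto_extend_of_strictMono hφ hu)).comp hφ.tendsto_atTop
  refine h.congr fun i => ?_
  simp only [Function.comp_apply, hφ.injective.extend_apply]

/-- **Firing in windows passes to continuous limits.**  If for every `k`, eventually in `j`, the forward
shell `n₀ + k` of frame `j` reaches level `c` at some log-time of the window `[σ₀, σ₀ + g k]`, then the
continuous limit reaches level `c` in the same window, for every `k`.
[cite: Tao2016AveragedNS, §4 (statement shape only); elementary (Bolzano–Weierstrass + continuous convergence)] -/
theorem persistentFiring_of_windows {V : ℕ → ℤ → ℝ → ℝ} {W : ℤ → ℝ → ℝ}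
    (hcc : ∀ (n : ℤ) (u : ℕ → ℝ) (σ : ℝ), Tendsto u atTop (𝓝 σ) →
      Tendsto (fun j => V j n (u j)) atTop (𝓝 (W n σ)))
    {c σ₀ : ℝ} {g : ℕ → ℝ} {n₀ : ℤ}
    (hfire : ∀ k : ℕ, ∀ᶠ j in atTop, ∃ τ : ℝ, σ₀ ≤ τ ∧ τ ≤ σ₀ + g k ∧ c ≤ |V j (n₀ + k) τ|) :
    ∀ k : ℕ, ∃ σ : ℝ, σ₀ ≤ σ ∧ σ ≤ σ₀ + g k ∧ c ≤ |W (n₀ + k) σ| := by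
  intro k
  obtain ⟨J, hJ⟩ := Filter.eventually_atTop.1 (hfire k)
  choose τ hτ using fun j : ℕ => hJ (j + J) (Nat.le_add_left J j)
  have hmem : ∀ j, τ j ∈ Icc σ₀ (σ₀ + g k) := fun j => ⟨(hτ j).1, (hτ j).2.1⟩
  obtain ⟨σs, hσs, ψ, hψ, hlim⟩ := isCompact_Icc.tendsto_subseq hmem
  have hφ : StrictMono (fun i => ψ i + J) := fun a b hab => Nat.add_lt_add_right (hψ hab) J
  have hV := tendsto_subseq_of_cc hcc (n₀ + k) hφ hlim
  have habs : Tendsto (fun i => |V (ψ i + J) (n₀ + k) ((τ ∘ ψ) i)|) atTop (𝓝 |W (n₀ + k) σs|) :=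
    (continuous_abs.tendsto _).comp hV
  refine ⟨σs, hσs.1, hσs.2, ge_of_tendsto' habs fun i => ?_⟩
  exact (hτ (ψ i)).2.2

/-! ## The kill criterion of record for door D4′ -/

/-- **KILL CRITERION OF RECORD (scalar frames, firing in windows).**  Suppose that at arbitrarily small
`ε₀` there are scalar frames `V_j : ℤ → ℝ → ℝ` solving the renormalised dyadic lattice (`Λ = bigLam ε₀`) on
half-lines `σ > A_j`, `A_j → −∞`, with a uniform bound `|V_j| ≤ B`, a uniform window-mass bound
`∫_a^b |V_j n| ≤ M` (`A_j < a ≤ b`), per-shell forward energy bounds `e^{2σ}V_j n(σ)² ≤ P_n` (`σ ≥ σ₁(n)`,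
uniform in `j`), and FIRING IN WINDOWS: some level `c > 0`, base shell `n₀`, log-time `σ₀` and widths
`g_k` such that for every `k`, eventually in `j`, shell `n₀ + k` of frame `j` reaches `|V_j| ≥ c` inside
`[σ₀, σ₀ + g_k]`.  Then `TailRatchet` fails.
[cite: Tao2016AveragedNS, §1.2, §4 Lemma 4.1 (4.8), §6.4; cell vocabulary] -/
theorem tailRatchet_false_of_scalarFramesWindow
    (hF : ∀ ε : ℝ, 0 < ε → ∃ ε₀ : ℝ, 0 < ε₀ ∧ ε₀ ≤ ε ∧
      ∃ (V : ℕ → ℤ → ℝ → ℝ) (A : ℕ → ℝ) (B M : ℝ),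
        Tendsto A atTop atBot ∧
        (∀ (j : ℕ) (n : ℤ) (σ : ℝ), A j < σ → HasDerivAt (V j n)
          (-(V j n σ) + bigLam ε₀ * V j (n - 1) σ ^ 2 - (bigLam ε₀)⁻¹ * V j n σ * V j (n + 1) σ) σ) ∧
        (∀ (j : ℕ) (n : ℤ) (σ : ℝ), A j < σ → |V j n σ| ≤ B) ∧
        (∀ (j : ℕ) (n : ℤ) (a b : ℝ), A j < a → a ≤ b → ∫ u in a..b, |V j n u| ≤ M) ∧
        (∀ n : ℤ, ∃ σ₁ P : ℝ, ∀ (j : ℕ) (σ : ℝ), σ₁ ≤ σ → A j < σ →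
          Real.exp (2 * σ) * V j n σ ^ 2 ≤ P) ∧
        (∃ c : ℝ, 0 < c ∧ ∃ (n₀ : ℤ) (σ₀ : ℝ) (g : ℕ → ℝ), ∀ k : ℕ, ∀ᶠ j in atTop,
          ∃ τ : ℝ, σ₀ ≤ τ ∧ τ ≤ σ₀ + g k ∧ c ≤ |V j (n₀ + k) τ|)) :
    ¬ TailRatchet := by
  refine tailRatchet_false_of_scalarPersistentFiring fun ε hε => ?_
  obtain ⟨ε₀, hε₀, hle, V, A, B, M, hA, hlaw, hB, hmass, hfwd, ⟨c, hc, n₀, σ₀, g, hfire⟩⟩ := hF ε hε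
  have hΛ : 0 < bigLam ε₀ := bigLam_pos (by linarith)
  have hev : ∀ a : ℝ, ∀ᶠ j in atTop, A j < a := fun a => hA.eventually (eventually_lt_atBot a)
  -- Arzelà–Ascoli
  have hBB : ∀ (n : ℤ) (a : ℝ), ∃ C : ℝ, ∃ J : ℕ, ∀ j, J ≤ j → ∀ u : ℝ, a ≤ u → ‖V j n u‖ ≤ C := by
    intro n a
    obtain ⟨J, hJ⟩ := eventually_atTop.1 (hev a)
    exact ⟨B, J, fun j hj u hu => by
      rw [Real.norm_eq_abs]; exact hB j n u (lt_of_lt_of_le (hJ j hj) hu)⟩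
  have hLL : ∀ (n : ℤ) (a : ℝ), ∃ K : ℝ, ∃ J : ℕ, ∀ j, J ≤ j → ∀ u v : ℝ, a ≤ u → a ≤ v →
      ‖V j n u - V j n v‖ ≤ K * |u - v| := by
    intro n a
    obtain ⟨J, hJ⟩ := eventually_atTop.1 (hev a)
    exact ⟨B + (bigLam ε₀ + (bigLam ε₀)⁻¹) * B ^ 2, J, fun j hj u v hu hv => by
      rw [Real.norm_eq_abs]
      exact frame_lipschitz hΛ (hlaw j) (hB j) n (lt_of_lt_of_le (hJ j hj) hu)
        (lt_of_lt_of_le (hJ j hj) hv)⟩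
  obtain ⟨φ, hφ, W, hW⟩ :=
    Summit.NavierStokesRegularity.NavierStokesRegularity.Cruxes.MinimalBlowupExtraction.Extraction.exists_subseq_continuousLimit
      V hBB hLL
  have hφt : Tendsto φ atTop atTop := hφ.tendsto_atTop
  -- the limit object along the subsequence
  obtain ⟨hWlaw, hWact, hWfwd, hWbd, -⟩ := scalarEternal_of_frameLimit (V := fun j => V (φ j))
    (A := fun j => A (φ j)) hΛ (hA.comp hφt) (fun j => hlaw (φ j)) (fun j => hB (φ j))
    (fun j => hmass (φ j)) (fun n => by
      obtain ⟨σ₁, P, hP⟩ := hfwd n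
      exact ⟨σ₁, P, fun j σ hσ hj => hP (φ j) σ hσ hj⟩) hW
  -- firing in windows along the subsequence
  have hfireW := persistentFiring_of_windows (V := fun j => V (φ j)) hW (g := g)
    (fun k => hφt.eventually (hfire k))
  obtain ⟨Mact, hMact⟩ : ∃ M' : ℝ, ∀ n : ℤ, Integrable (fun σ => |W n σ|) ∧ ∫ σ, |W n σ| ≤ M' :=
    ⟨M, hWact⟩
  refine ⟨ε₀, hε₀, hle, W, hWlaw, ⟨Mact, hMact⟩, hWfwd, ⟨B, hWbd⟩, c, hc, n₀, σ₀, fun K => ?_⟩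
  obtain ⟨σ, hσ₀, -, hge⟩ := hfireW K
  exact ⟨K, le_rfl, σ, hσ₀, hge⟩

end WakeRatchetDyadicScalarEternal

end Summit.NavierStokesRegularity.NavierStokesRegularity.Theorems

end
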